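import Mathlib
import HarnessLib
import Summits.HubbardSuperconductivity.HubbardSuperconductivity.Theorems.KLProgrammeKLRegimeKernelNormsLevelsDefs
import Summits.HubbardSuperconductivity.HubbardSuperconductivity.Theorems.KLProgrammeKLRegimeSplitSlotsV17F2
import Summits.HubbardSuperconductivity.HubbardSuperconductivity.Theorems.KLProgrammeKLRegimeEngineV8DefsU6
import Summits.HubbardSuperconductivity.HubbardSuperconductivity.Theorems.KLProgrammeKLRegimeEngineV8DefsU9
import Summits.HubbardSuperconductivity.HubbardSuperconductivity.Theorems.KLProgrammeKLRegimeEngineV8WithCR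

/-!
# Route `KLProgramme` — ENGINE child gen 8 (stmt-HubbardSuperconductivity-20437 `KLRegimeEngineV17F2`), SKELETON v2 (plan g17 (R47), KL STATUS
# 2026-08-27T13:26:08Z): the TOWER EXPORTS — U-currency single-level kernel sizes at the flow frame, the deferred constant table, the step Prop
# (cell gate-hubbard-kl, seat p5 g6 = owner of the export-Prop TEXT; SHAPE to be signed off by the E1 lanes r2d-p2 / k3c2-p3 — DRAFT, NOT FILED)

WHY (FINDING (E5-CR), (R47)(1)): stub (c) budgets the E.5 two-vertex classes in `eremBar`'s `Q.CR·(P.Klam·|U|)³·2^{−n}` (U-currency) but v1 hands it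
the degree ≥ 6 kernels only through the public `Q.CE^p·ε_n^{p−1}` laws (`KernelNormsV4`/`KernelNormsLevels`/`klWtBudget`), and `Q.CE³ ≫ Q.CR` in the
package with no sane U-door repairing it.  CURE (a) = skeleton v2: stub (b) v2 EXPORTS, in (b)→(c) internal currency, the single-level sizes of ALL
degrees `2p ≥ 6` in U-currency with a tower-closed constant TABLE, stub (c) v2 takes them as hypotheses, and `klEngQ8` raises `CR` by a closed term of
that table.  The E.5 tail needs every degree (the `k`-line class pairs kernels of degrees `k + m₀ + 1` and `k + m₁`), hence a TABLE `c : ℕ → ℝ` with a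
geometric envelope (`c (p+1) ≤ A·c p`), not two constants `c₆, c₈`.

* §1 **`LevelsUAt L M c P β U μ K j`** — at frame `K`, level `j`: the quartic at any prescription without gain (`c 2·Klam|U|·2^j`) and `∀ p ≥ 3, ∀ Ωe,` klAnisoLegKernelNormAt … K klE0 j (2p) Ωe ≤
  c p · (P.Klam·|U|)^{p−1} · 2^{(3p−5)j} · (2^j)^{−levelGainExp (levelCount Ωe)}` (= `KernelNormsLevels` with the table `c` for `Q.CE^p` and `Klam|U|` for
  `ε_j`; G-, Q-, R-free); **`LevelsUExportAt L M c P β U μ n`** := `∀ j ≤ n, LevelsUAt … (klFlowFrameU L M β U μ n) j` (all levels at the flow frame `K_n`);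
  `LevelsUAt.mono`, `kernelNormsLevels_of_levelsUAt` (a table dominated by `Q.CE^p` gives the ε-currency law back: `Klam|U| ≤ ε_j`);
* §2 **`IsGeomTable c A`** := `(∀ p, 0 ≤ c p) ∧ 0 ≤ A ∧ ∀ p ≥ 3, c (p+1) ≤ A · c p` (the envelope the line-number tail sums: per extra line the vertex
  sizes grow by at most `A·Klam|U|·8^j`, against the Gram base `≍ 8^{−j}`);
* §3 the STEP Prop **`LevelsUStep P R Q₀ c u`** (`EngConsts.withCR` from `…EngineV8WithCR`): for every `G` (`G.WF`, (R47f)(2)) and `r ≥ Q₀.CR`, under the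
  stub binders of the engine-flow skeleton (doors `klEngC₃6`, `klEngU₀9`, `klEngL₃`, `klEngM₃`; `0 ≤ n ≤ nScales β + 1`, `IsKLRegime`) and below the
  step's OWN deferred threshold `U ≤ u r cc` (whatever CR-smallness the tower needs — never a guessed numeral; the v2 U-door `klEngU₀10` takes `min`
  with the deferred `klCUu`), the history `HistP klPredsV17F2 L M G P (Q₀.withCR r) R β U μ 0 n`, `FrameOK … (K_n)` and the exports at every
  `j < n` ⟹ `LevelsUExportAt … c … n`; `IsExportPkg (c, A, u)` := geometric table + positive threshold.
  Quantifying over `r` (the package `Q₀.withCR r`, every other field of `Q₀` fixed) is what makes the deferred table below `Q₈`-INDEPENDENT although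
  `klEngQ8 := (klEngQ7 P R).withCR (max …)` is built FROM it — no circularity; the skeleton instantiates `Q₀ := klEngQ7 P R`;
* §4 the DEFERRED PACKAGE `klExportPkg P R Q₀` := `if h : ∃ e, IsExportPkg e ∧ LevelsUStep P R Q₀ e.1 e.2.2 then Classical.choose h else (0, 0, 1)` and its
  projections **`klCU`** (table), **`klCUA`** (ratio), **`klCUu`** (threshold); `isGeomTable_klCU`, `klCU_nonneg`, `klCUA_nonneg`, **`klCUu_pos`**
  (all unconditional), **`levelsUStep_klCU_of_exists`/`_of`** (`choose_spec`) — total today, adequate the day the E1 tower proves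
  `LevelsUStep P R (klEngQ7 P R) c u` for ANY admissible closed package (the #7/#12 `dite` pattern of (R47)(3)).

Definitions with bodies + bookkeeping; nothing about the model is asserted; nothing asserts superconductivity.  The E.5 constants `c₃, c₄, c₄′` of
`klEngQ8`'s raise (closed terms of the table × this lane's tail closed forms p531120/p532413/p533230 × the line-data constants) are a separate module.
-/

noncomputable section

namespace Summit.HubbardSuperconductivity.HubbardSuperconductivity.Theorems.KLRegimeSplit

set_option linter.dupNamespace false -- summit = problem name (single-conjunct summit), D-0017

open Real Finset Literature.MathematicalPhysics.QuantumLattice Literature.Probability.LatticeModels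
open Literature.MathematicalPhysics.QuantumLattice.FermiRG
open Summit.HubbardSuperconductivity.HubbardSuperconductivity.Theorems.KLProgrammeLegKernels
open Summit.HubbardSuperconductivity.HubbardSuperconductivity.Theorems.DispersionFlow
open Summit.HubbardSuperconductivity.HubbardSuperconductivity.Theorems.EngineV8

/-! ## §1 U-currency single-level sizes -/

section Model

variable (L M : ℕ) [NeZero L]

/-- **`LevelsUAt L M c P β U μ K j`** — the levelled kernel sizes of the scale-`j` action at frame `K` in U-CURRENCY with the constant table `c`:
the QUARTIC at any prescription without gain, `‖W^{(j)}_4[K]‖_{Ωe} ≤ c 2 · Klam|U| · 2^j` (its fixed-tuple sizes stay the (E5-F) currency; (q1′) of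
KL STATUS 13:40:54Z), and for every `p ≥ 3` and every prescription `Ωe` of the `2p` legs
`‖W^{(j)}_{2p}[K]‖_{Ωe} ≤ c p · (Klam|U|)^{p−1} · 2^{(3p−5)j} · (2^j)^{−levelGainExp (levelCount Ωe)}`. -/
def LevelsUAt (c : ℕ → ℝ) (P : SplitConsts) (β U μ : ℝ) (K : TrigPolyC4v) (j : ℕ) : Prop :=
  (∀ Ωe : Fin 4 → Option (SectorLeg (sectorCount j)), klAnisoLegKernelNormAt L M β U μ K klE0 j 4 Ωe ≤ c 2 * (P.Klam * |U|) * (2 : ℝ) ^ j) ∧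
  ∀ p : ℕ, 3 ≤ p → ∀ Ωe : Fin (2 * p) → Option (SectorLeg (sectorCount j)),
    klAnisoLegKernelNormAt L M β U μ K klE0 j (2 * p) Ωe ≤
      c p * (P.Klam * |U|) ^ (p - 1) * (2 : ℝ) ^ ((3 * (p : ℤ) - 5) * j) * (((2 : ℝ) ^ j)⁻¹) ^ levelGainExp (levelCount Ωe)

variable [NeZero M]

/-- **`LevelsUExportAt L M c P β U μ n`** — the export of the one-shot tower at scale `n`: the U-currency sizes at EVERY level `j ≤ n` of the flow
frame `K_n = klFlowFrameU L M β U μ n`. -/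
def LevelsUExportAt (c : ℕ → ℝ) (P : SplitConsts) (β U μ : ℝ) (n : ℕ) : Prop :=
  ∀ j ≤ n, LevelsUAt L M c P β U μ (klFlowFrameU L M β U μ n) j

variable {L M}

omit [NeZero M] in
/-- Table monotonicity. -/
theorem LevelsUAt.mono {c c' : ℕ → ℝ} {P : SplitConsts} (hK : 0 ≤ P.Klam) {β U μ : ℝ} {K : TrigPolyC4v} {j : ℕ}
    (h : LevelsUAt L M c P β U μ K j) (hcc : ∀ p, 2 ≤ p → c p ≤ c' p) : LevelsUAt L M c' P β U μ K j := by
  have hKU : (0 : ℝ) ≤ P.Klam * |U| := mul_nonneg hK (abs_nonneg U)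
  refine ⟨fun Ωe => (h.1 Ωe).trans ?_, fun p hp Ωe => (h.2 p hp Ωe).trans ?_⟩
  · have h2 : (0 : ℝ) ≤ (2 : ℝ) ^ j := by positivity
    exact mul_le_mul_of_nonneg_right (mul_le_mul_of_nonneg_right (hcc 2 le_rfl) hKU) h2
  · have h1 : (0 : ℝ) ≤ (P.Klam * |U|) ^ (p - 1) := pow_nonneg hKU _
    have h2 : (0 : ℝ) ≤ (2 : ℝ) ^ ((3 * (p : ℤ) - 5) * j) := zpow_nonneg (by norm_num) _
    have h3 : (0 : ℝ) ≤ (((2 : ℝ) ^ j)⁻¹) ^ levelGainExp (levelCount Ωe) := by positivity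
    exact mul_le_mul_of_nonneg_right (mul_le_mul_of_nonneg_right (mul_le_mul_of_nonneg_right (hcc p (by omega)) h1) h2) h3

/-- Export monotonicity. -/
theorem LevelsUExportAt.mono {c c' : ℕ → ℝ} {P : SplitConsts} (hK : 0 ≤ P.Klam) {β U μ : ℝ} {n : ℕ}
    (h : LevelsUExportAt L M c P β U μ n) (hcc : ∀ p, 2 ≤ p → c p ≤ c' p) : LevelsUExportAt L M c' P β U μ n :=
  fun j hj => (h j hj).mono hK hcc

omit [NeZero M] in
/-- `ε_j = Klam|U|·(1 + |U|j) ≥ Klam|U|`. -/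
theorem klam_mul_abs_le_epsCoupling {P : SplitConsts} (hK : 0 ≤ P.Klam) (U : ℝ) (j : ℕ) : P.Klam * |U| ≤ epsCoupling P U j := by
  rw [epsCoupling]
  have h1 : (0 : ℝ) ≤ U ^ 2 * j := by positivity
  nlinarith

omit [NeZero M] in
/-- **Back to the public currency**: a U-currency table dominated by `Q.CE^p` gives `KernelNormsLevels` at the same frame and level. -/
theorem kernelNormsLevels_of_levelsUAt {c : ℕ → ℝ} {P : SplitConsts} {Q : EngConsts} {β U μ : ℝ} (hK : 0 ≤ P.Klam) (hCE : 0 ≤ Q.CE)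
    {K : TrigPolyC4v} {j : ℕ} (h : LevelsUAt L M c P β U μ K j) (hc : ∀ p, 3 ≤ p → c p ≤ Q.CE ^ p) :
    KernelNormsLevels L M P Q β U μ K j := by
  intro p hp Ωe
  refine (h.2 p hp Ωe).trans ?_
  have hA : (0 : ℝ) ≤ (P.Klam * |U|) ^ (p - 1) := pow_nonneg (mul_nonneg hK (abs_nonneg U)) _
  have h1 : (P.Klam * |U|) ^ (p - 1) ≤ epsCoupling P U j ^ (p - 1) :=
    pow_le_pow_left₀ (mul_nonneg hK (abs_nonneg U)) (klam_mul_abs_le_epsCoupling hK U j) _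
  have h2 : (0 : ℝ) ≤ (2 : ℝ) ^ ((3 * (p : ℤ) - 5) * j) := zpow_nonneg (by norm_num) _
  have h3 : (0 : ℝ) ≤ (((2 : ℝ) ^ j)⁻¹) ^ levelGainExp (levelCount Ωe) := by positivity
  have h12 : c p * (P.Klam * |U|) ^ (p - 1) ≤ Q.CE ^ p * epsCoupling P U j ^ (p - 1) :=
    (mul_le_mul_of_nonneg_right (hc p hp) hA).trans (mul_le_mul_of_nonneg_left h1 (pow_nonneg hCE p))
  exact mul_le_mul_of_nonneg_right (mul_le_mul_of_nonneg_right h12 h2) h3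

end Model

/-! ## §2 Geometric constant tables -/

/-- **`IsGeomTable c A`** — a nonnegative table with envelope ratio `A`: `c (p+1) ≤ A · c p` from degree `6` on. -/
def IsGeomTable (c : ℕ → ℝ) (A : ℝ) : Prop := (∀ p, 0 ≤ c p) ∧ 0 ≤ A ∧ ∀ p, 3 ≤ p → c (p + 1) ≤ A * c p

/-- The envelope iterated: `c (3 + i) ≤ A^i · c 3`. -/
theorem IsGeomTable.le_pow {c : ℕ → ℝ} {A : ℝ} (h : IsGeomTable c A) (i : ℕ) : c (3 + i) ≤ A ^ i * c 3 := by
  induction i with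
  | zero => simp
  | succ i ih =>
      calc c (3 + (i + 1)) = c (3 + i + 1) := by rw [Nat.add_assoc]
        _ ≤ A * c (3 + i) := h.2.2 _ (by omega)
        _ ≤ A * (A ^ i * c 3) := mul_le_mul_of_nonneg_left ih h.2.1
        _ = A ^ (i + 1) * c 3 := by ring

/-- The zero table is geometric (ratio `0`). -/
theorem isGeomTable_zero : IsGeomTable (fun _ => 0) 0 := ⟨fun _ => le_rfl, le_rfl, fun _ _ => by simp⟩

/-! ## §3 The step Prop -/

/-- **`LevelsUStep P R Q₀ c u`** — the tower's step in U-currency: for every geometry package `G` (`G.WF`; the tower reads `G` only through the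
history — (R47f)(2), so the v2 render may instantiate `G := klEngGeo8`), every raised `CR`-value `r ≥ Q₀.CR` and under the stub binders of the engine-flow
skeleton, for couplings below the v1 door `klEngU₀9` AND below the step's OWN threshold `u r cc` (a deferred positive function of the raised `CR` and the
regime constant — whatever CR-smallness the tower needs, never a guessed numeral), the history at the package `Q₀.withCR r`, the admissibility of `K_n`
and the exports at every `j < n` give the export at `n` (from `n = 0`: the scale-`0` export has an empty export history). -/
def LevelsUStep (P : SplitConsts) (R : RenConsts) (Q₀ : EngConsts) (c : ℕ → ℝ) (u : ℝ → ℝ → ℝ) : Prop :=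
  ∀ G : GeoConsts, G.WF → ∀ r : ℝ, Q₀.CR ≤ r →
    ∀ cc : ℝ, 0 < cc → cc ≤ klEngC₃6 P R →
      ∀ μ ∈ klWindowC, ∀ U : ℝ, 0 < U → U ≤ klEngU₀9 P R cc → U ≤ u r cc →
        ∀ β : ℝ, klBetaMin ≤ β → β ≤ Real.exp (cc / U ^ 2) →
          ∀ (L M : ℕ) [NeZero L] [NeZero M], klEngL₃ β U ≤ L → klEngM₃ β U L ≤ M →
            ∀ n : ℕ, n ≤ nScales β + 1 → IsKLRegime U cc (-(n : ℤ)) →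
              HistP klPredsV17F2 L M G P (Q₀.withCR r) R β U μ 0 n →
                FrameOK R U (nScales β) μ (klFlowFrameU L M β U μ n) →
                  (∀ j < n, LevelsUExportAt L M c P β U μ j) →
                    LevelsUExportAt L M c P β U μ n

/-- **An admissible export package**: a geometric table `c` with ratio `A` and a POSITIVE threshold function `u`. -/
def IsExportPkg (e : (ℕ → ℝ) × ℝ × (ℝ → ℝ → ℝ)) : Prop := IsGeomTable e.1 e.2.1 ∧ ∀ r cc, 0 < e.2.2 r cc

/-- The trivial package (zero table, ratio `0`, threshold `1`) is admissible. -/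
theorem isExportPkg_zero : IsExportPkg (fun _ => 0, 0, fun _ _ => 1) := ⟨isGeomTable_zero, fun _ _ => one_pos⟩

/-! ## §4 The deferred table, ratio and threshold -/

section Deferred

variable (P : SplitConsts) (R : RenConsts) (Q₀ : EngConsts)

/-- The deferred export package: SOME admissible `(c, A, u)` for which the tower's step holds, if one exists, else the trivial package. -/
def klExportPkg : (ℕ → ℝ) × ℝ × (ℝ → ℝ → ℝ) :=
  open scoped Classical in
  if h : ∃ e : (ℕ → ℝ) × ℝ × (ℝ → ℝ → ℝ), IsExportPkg e ∧ LevelsUStep P R Q₀ e.1 e.2.2 then Classical.choose h else (fun _ => 0, 0, fun _ _ => 1)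

/-- **The deferred U-currency table `klCU P R Q₀`** — a closed term today, adequate the day `LevelsUStep P R Q₀ c u` is proved for any admissible
package (then `levelsUStep_klCU_of_exists`). -/
def klCU : ℕ → ℝ := (klExportPkg P R Q₀).1

/-- **The deferred envelope ratio `klCUA P R Q₀`** of the table. -/
def klCUA : ℝ := (klExportPkg P R Q₀).2.1

/-- **The deferred coupling threshold `klCUu P R Q₀ r cc`** of the step (the v2 U-door `klEngU₀10` takes `min` with it at `r := (klEngQ8 P R).CR`). -/
def klCUu : ℝ → ℝ → ℝ := (klExportPkg P R Q₀).2.2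

/-- The deferred package is admissible (unconditionally). -/
theorem isExportPkg_klExportPkg : IsExportPkg (klExportPkg P R Q₀) := by
  classical
  unfold klExportPkg
  split_ifs with h
  · exact (Classical.choose_spec h).1
  · exact isExportPkg_zero

/-- The deferred table is geometric with the deferred ratio (unconditionally). -/
theorem isGeomTable_klCU : IsGeomTable (klCU P R Q₀) (klCUA P R Q₀) := (isExportPkg_klExportPkg P R Q₀).1

/-- `0 ≤ klCU P R Q₀ p`. -/
theorem klCU_nonneg (p : ℕ) : 0 ≤ klCU P R Q₀ p := (isGeomTable_klCU P R Q₀).1 p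

/-- `0 ≤ klCUA P R Q₀`. -/
theorem klCUA_nonneg : 0 ≤ klCUA P R Q₀ := (isGeomTable_klCU P R Q₀).2.1

/-- `0 < klCUu P R Q₀ r cc` (unconditionally) — so a `min` with it keeps a U-door positive. -/
theorem klCUu_pos (r cc : ℝ) : 0 < klCUu P R Q₀ r cc := (isExportPkg_klExportPkg P R Q₀).2 r cc

variable {P R Q₀}

/-- **The step holds for the deferred package as soon as it holds for some admissible package.** -/
theorem levelsUStep_klCU_of_exists (h : ∃ e : (ℕ → ℝ) × ℝ × (ℝ → ℝ → ℝ), IsExportPkg e ∧ LevelsUStep P R Q₀ e.1 e.2.2) :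
    LevelsUStep P R Q₀ (klCU P R Q₀) (klCUu P R Q₀) := by
  classical
  have hpkg : klExportPkg P R Q₀ = Classical.choose h := by
    unfold klExportPkg
    rw [dif_pos h]
  unfold klCU klCUu
  rw [hpkg]
  exact (Classical.choose_spec h).2

/-- Packaging an explicit witness. -/
theorem levelsUStep_klCU_of {c : ℕ → ℝ} {A : ℝ} {u : ℝ → ℝ → ℝ} (hg : IsGeomTable c A) (hu : ∀ r cc, 0 < u r cc)
    (hs : LevelsUStep P R Q₀ c u) : LevelsUStep P R Q₀ (klCU P R Q₀) (klCUu P R Q₀) :=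
  levelsUStep_klCU_of_exists ⟨(c, A, u), ⟨hg, hu⟩, hs⟩

end Deferred

end Summit.HubbardSuperconductivity.HubbardSuperconductivity.Theorems.KLRegimeSplit

end
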